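import Summits.Ventures.HSemireg.WedgeHankelRecurrenceGaussGramSchmidt

/-!
# Venture HSemireg — **UNIQUENESS OF THE MONIC ORTHOGONAL POLYNOMIAL AND OF THE GAUSS NODES**: for a positive discrete measure `(ν, w)` with more than `n` nodes, two monic polynomials of
# degree `n` both `(ν, w)`-orthogonal to every lower degree COINCIDE (their difference is orthogonal to itself); consequently the node polynomial of ANY `(t+1)`-point rule exact in degree
# `≤ 2t + 1` is THE orthogonal polynomial `q_{t+1}` (Gauss–Jacobi, N265), so all such rules share their node set

HONEST FRAMING. Part of the Lean index of the computation cell `pub-hsemireg` (seat p10 gen 42, Sunday typer «UNIFORM-IN-n»).  Real polynomials and finite sums only; no variety, no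
cohomology theory, no sheaf, no Ext group and no semiregularity map is constructed here; nothing here says that HC / HC_CM / HC_AV holds; no Literature fact (unproved `Prop`) is declared or
used.  Custodian versions as in `WedgeHankelSiegelIdeal` (1/3).
SOURCES (cited).  T. S. Chihara, *An Introduction to Orthogonal Polynomials* (1978), Ch. I Thm 3.1 (uniqueness of the monic OPS) and Thm 6.1 ∕ §6 (the Gauss nodes are the zeros of `P_n`);
G. Szegő, *Orthogonal Polynomials*, Thm 2.2 ∕ Thm 3.4.1; this lineage's `moments_unique` (Gantmacher XV Thm 18 (3)) for the full rule.
PROOF TYPED HERE.  `d = P − Q` has degree `< n` and `Σν (P − Q) d = Σν P d − Σν Q d = 0`, i.e. `Σν d² = 0`, so `d = 0` (N273 `eq_zero_of_sum_mul_eval_sq_eq_zero`).  For a rule exact in degree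
`≤ 2t + 1`, N265 gives the orthogonality of its node polynomial.
DEDUP DISCLOSURE (`rg -n 'orthogonal_unique|monic_unique' Summits/Ventures/HSemireg/WedgeHankelRecurrence*`, 2026-09-03): `moments_unique` (N2xx) is the uniqueness of nodes AND weights of
two `(t+1)`-atomic rules agreeing to degree `2t + 1`; this file is the polynomial-side uniqueness against a general integrating measure.  The 3 names below: 0 hits tree-wide.

WHAT IS IN THE TREE.  N265 `sum_mul_eval_nodePoly_mul_eq_zero`; N273 `eq_zero_of_sum_mul_eval_sq_eq_zero`, `natDegree_sub_lt_of_monic_of_natDegree_eq`; N289 `exists_orthogonal_system_lower`.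
THIS FILE (namespace `Summit.Ventures.HSemireg.Wedge.HankelOuter` continued; CHAINED on N289 (import), N265, N273; 0 definitions):
* §1055 **`orthogonal_monic_unique`** (Chihara I Thm 3.1, uniqueness), **`nodePoly_eq_of_exact`** (the node polynomial of a rule exact in degree `≤ 2t + 1` equals any monic degree-`(t+1)`
  polynomial orthogonal to lower degrees), `gauss_nodes_range_eq` (two such rules with strictly increasing nodes have the same nodes).
CAVEATS.  Nothing Ext-side.  New names only.
-/

open Module Polynomial
open scoped Matrix Polynomial

namespace Summit.Ventures.HSemireg.Wedge.HankelOuter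

/-! ## §1055. Uniqueness of the orthogonal polynomial -/

/-- **UNIQUENESS OF THE MONIC ORTHOGONAL POLYNOMIAL**: with `ν > 0`, `w` injective on `Fin N`, `n ≤ N`, two monic `P, Q` of degree `n`, each `(ν, w)`-orthogonal to all `G` with `deg G < n`,
are equal. [Chihara I Thm 3.1; this file, §1055] -/
theorem orthogonal_monic_unique {N n : ℕ} {ν w : Fin N → ℝ} (hν : ∀ l, 0 < ν l) (hw : Function.Injective w) (hnN : n ≤ N) {P Q : ℝ[X]} (hPm : P.Monic) (hPd : P.natDegree = n)
    (hQm : Q.Monic) (hQd : Q.natDegree = n) (hPo : ∀ G : ℝ[X], G.natDegree < n → ∑ l, ν l * (P * G).eval (w l) = 0)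
    (hQo : ∀ G : ℝ[X], G.natDegree < n → ∑ l, ν l * (Q * G).eval (w l) = 0) : P = Q := by
  rcases Nat.eq_zero_or_pos n with h0 | hpos
  · subst h0
    rw [eq_one_of_monic_natDegree_zero hPm hPd, eq_one_of_monic_natDegree_zero hQm hQd]
  · have hd : (P - Q).natDegree < n := natDegree_sub_lt_of_monic_of_natDegree_eq hpos hPm hPd hQm hQd
    have hself : ∑ l, ν l * ((P - Q).eval (w l)) ^ 2 = 0 := by
      have h1 := hPo (P - Q) hd
      have h2 := hQo (P - Q) hd
      have e : ∀ l, ν l * ((P - Q).eval (w l)) ^ 2 = ν l * (P * (P - Q)).eval (w l) - ν l * (Q * (P - Q)).eval (w l) := fun l => by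
        simp only [eval_mul, eval_sub]; ring
      rw [Finset.sum_congr rfl fun l _ => e l, Finset.sum_sub_distrib, h1, h2, sub_zero]
    exact sub_eq_zero.1 (eq_zero_of_sum_mul_eval_sq_eq_zero hν hw (lt_of_lt_of_le hd hnN) hself)

/-- **The node polynomial of a Gauss-exact rule is the orthogonal polynomial**: if the `(t+1)`-point rule `(μ, v)` is exact in degree `≤ 2t + 1` against `(ν, w)` (`ν > 0`, `w` injective,
`t + 1 ≤ N`) and `Q` is monic of degree `t + 1`, `(ν, w)`-orthogonal to lower degrees, then `∏_j (X − v_j) = Q`. [Chihara I Thm 6.1; Szegő Thm 3.4.1; this file, §1055] -/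
theorem nodePoly_eq_of_exact {t N : ℕ} {μ v : Fin (t + 1) → ℝ} {ν w : Fin N → ℝ} (hν : ∀ l, 0 < ν l) (hw : Function.Injective w) (hN : t + 1 ≤ N)
    (hmom : ∀ p, p ≤ 2 * t + 1 → ∑ j, μ j * v j ^ p = ∑ l, ν l * w l ^ p) {Q : ℝ[X]} (hQm : Q.Monic) (hQd : Q.natDegree = t + 1)
    (hQo : ∀ G : ℝ[X], G.natDegree < t + 1 → ∑ l, ν l * (Q * G).eval (w l) = 0) : ∏ j, (Polynomial.X - C (v j)) = Q := by
  have hPm : (∏ j, (Polynomial.X - C (v j))).Monic := monic_prod_of_monic _ _ fun j _ => monic_X_sub_C (v j)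
  have hPd : (∏ j, (Polynomial.X - C (v j))).natDegree = t + 1 := by
    rw [natDegree_prod_of_monic _ _ fun j _ => monic_X_sub_C (v j)]
    simp only [natDegree_X_sub_C, Finset.sum_const, Finset.card_univ, Fintype.card_fin, smul_eq_mul, mul_one]
  exact orthogonal_monic_unique hν hw hN hPm hPd hQm hQd (fun G hG => sum_mul_eval_nodePoly_mul_eq_zero hmom (by omega)) hQo

/-- **Two Gauss-exact rules have the same nodes**: if `(μ, v)` and `(μ′, v′)` are `(t+1)`-point rules with strictly increasing nodes, both exact in degree `≤ 2t + 1` against the same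
positive `(ν, w)` (`t + 1 ≤ N`), then `v = v′`. [Chihara I §6; cf. `moments_unique`; this file, §1055] -/
theorem gauss_nodes_range_eq {t N : ℕ} {μ v μ' v' : Fin (t + 1) → ℝ} {ν w : Fin N → ℝ} (hν : ∀ l, 0 < ν l) (hw : Function.Injective w) (hN : t + 1 ≤ N) (hv : StrictMono v)
    (hv' : StrictMono v') (hmom : ∀ p, p ≤ 2 * t + 1 → ∑ j, μ j * v j ^ p = ∑ l, ν l * w l ^ p) (hmom' : ∀ p, p ≤ 2 * t + 1 → ∑ j, μ' j * v' j ^ p = ∑ l, ν l * w l ^ p) :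
    v = v' := by
  have hPm : (∏ j, (Polynomial.X - C (v' j))).Monic := monic_prod_of_monic _ _ fun j _ => monic_X_sub_C (v' j)
  have hPd : (∏ j, (Polynomial.X - C (v' j))).natDegree = t + 1 := by
    rw [natDegree_prod_of_monic _ _ fun j _ => monic_X_sub_C (v' j)]
    simp only [natDegree_X_sub_C, Finset.sum_const, Finset.card_univ, Fintype.card_fin, smul_eq_mul, mul_one]
  have heq := nodePoly_eq_of_exact hν hw hN hmom hPm hPd (fun G hG => sum_mul_eval_nodePoly_mul_eq_zero hmom' (by omega))
  -- every `v_i` is a root of `∏ (X − v′_j)`, hence among the `v′`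
  have hmem : ∀ i, v i ∈ Set.range v' := fun i => by
    have h0 : (∏ j, (Polynomial.X - C (v' j))).eval (v i) = 0 := by
      rw [← heq, eval_prod]; exact Finset.prod_eq_zero (Finset.mem_univ i) (by simp)
    rw [eval_prod, Finset.prod_eq_zero_iff] at h0
    obtain ⟨j, -, hj⟩ := h0
    rw [eval_sub, eval_X, eval_C, sub_eq_zero] at hj
    exact ⟨j, hj.symm⟩
  have hsub : Finset.univ.image v ⊆ Finset.univ.image v' := fun x hx => by
    obtain ⟨i, -, rfl⟩ := Finset.mem_image.1 hx
    obtain ⟨j, hj⟩ := hmem i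
    exact Finset.mem_image.2 ⟨j, Finset.mem_univ _, hj⟩
  have hcard : (Finset.univ.image v').card ≤ (Finset.univ.image v).card := by
    rw [Finset.card_image_of_injective _ hv.injective, Finset.card_image_of_injective _ hv'.injective]
  have hfin := Finset.eq_of_subset_of_card_le hsub hcard
  have hrange : Set.range v = Set.range v' := by
    rw [← Set.image_univ, ← Set.image_univ, ← Finset.coe_univ, ← Finset.coe_image, ← Finset.coe_image, hfin]
  exact (hv.range_inj hv').1 hrange

end Summit.Ventures.HSemireg.Wedge.HankelOuter
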